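import Literature.NumberTheory.LFunctions.SatheSelbergEulerProduct
import HarnessLib

/-!
# The Euler product of `Σ z^{s(n)} n^{-s}` for the capped prime-factor count `s(n) = Σ_{p^v ∥ n} min(v, 2)`

Topic `Literature/NumberTheory/LFunctions`. Everything here is PROVED (theorems only; no
definitions, no named facts). Companion of `SatheSelbergEulerProduct.lean` (`z^{ω(n)}`,
Montgomery–Vaughan §7.4.1 Exercise 3) and `SelbergDelangeOmegaEulerProduct.lean` (`z^{Ω(n)}`, (7.60))
for the CAPPED count `s(n) = Σ_{p^v ∥ n} min(v, 2)` (in Lean `n.factorization.sum fun _ v => min v 2`),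
an additive function with `s(p) = 1`, `s(p^v) = 2` (`v ≥ 2`), `ω ≤ s ≤ Ω`, `s ≤ 2ω`.

For complex `z` the multiplicative coefficients `a_z(n) = z^{s(n)}` have
`Σ a_z(n) n^{-s} = ∏_p (1 + z q + z² q²/(1 − q))` (`q = p^{-s}`, `σ > 1`; absolute convergence by
comparison with `Σ (max(1,|z|)²)^{ω(n)} n^{-σ}`), so that `Σ a_z(n) n^{-s} = ζ(s)^z F(s, z)` with
Selberg's factors `E(q, z) = (1 + z q + z² q²/(1 − q)) · exp(z Log(1 − q))` — polynomials in `z`, so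
that (unlike `Ω`, where `p = 2` forces `|z| < 2`) every `z` is admissible. For an abstract `q` with
`‖q‖ ≤ 3/4` (every `p^{-s}`, `σ ≥ 1/2`) we prove:

* `norm_capFactor_sub_one_le` — quadratic closeness `‖E − 1‖ ≤ 20(|z| + |z|²)‖q‖²` when
  `|z|‖q‖ ≤ 1/4` (the first-order terms `zq` cancel; MV §7.4.1 Exercise 3(a) for `ω`);
* `norm_capFactor_le` — the explicit bound `‖E‖ ≤ exp(30 (1+R)^{3/2} ‖q‖^{3/2})` for `‖z‖ ≤ R`
  (from the quadratic closeness if `|z|‖q‖ ≤ 1/4`, since `|z|²t² ≤ ½(|z|t)^{3/2}` there; otherwise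
  from the crude bound `(1 + u + 4u²)e^{5u/2} ≤ e^{19u^{3/2}}`, `u = |z|‖q‖ ≥ 1/4`). The exponent
  `3/2` makes `Σ_p (p^{-σ})^{3/2}` converge down to `σ = 4/5` while keeping the growth `(1+R)^{3/2}`
  needed when `R ≍ log log x` (Selberg–Delange with uniformity in `z`, Tenenbaum II.5–II.6).

## References

* [MontgomeryVaughan2007] H. L. Montgomery, R. C. Vaughan, *Multiplicative Number Theory I*,
  CUP 2007, §7.4 (Theorem 7.18, (7.60)) and §7.4.1 Exercise 3.
* [Tenenbaum2015] G. Tenenbaum, *Introduction to analytic and probabilistic number theory*, 3rd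
  ed., AMS GSM 163, II.5 §5.1 and II.6 §6.1.
* [Selberg1954] A. Selberg, *Note on a paper by L. G. Sathe*, J. Indian Math. Soc. 18 (1954) 83–87.
-/

noncomputable section

namespace Literature.NumberTheory.LFunctions

namespace SelbergDelangeCapped

open Complex LSeries Filter Topology Finset
open scoped ArithmeticFunction.omega

/-! ### The coefficients `z^{s(n)}` -/

/-- `s(n) ≤ 2 ω(n)`. [folklore] -/
theorem capExp_le (n : ℕ) : (n.factorization.sum fun _ v => min v 2) ≤ 2 * ω n := by
  rw [Finsupp.sum, ArithmeticFunction.cardDistinctFactors_apply, ← List.card_toFinset,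
    Nat.toFinset_factors, ← Nat.support_factorization, Finset.card_eq_sum_ones, Finset.mul_sum]
  exact Finset.sum_le_sum fun p _ ↦ by omega

/-- Domination `‖a_z(n)‖ ≤ (max(1,|z|)²)^{ω(n)}` by the tree's `omegaCoeff`. [folklore] -/
theorem norm_coeff_le (z : ℂ) (n : ℕ) :
    ‖z ^ (n.factorization.sum fun _ v => min v 2)‖ ≤
      ‖SatheSelberg.omegaCoeff (((max 1 ‖z‖) ^ 2 : ℝ) : ℂ) n‖ := by
  rw [norm_pow, SatheSelberg.norm_omegaCoeff, Complex.norm_real,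
    Real.norm_of_nonneg (by positivity), ← pow_mul]
  calc ‖z‖ ^ (n.factorization.sum fun _ v => min v 2)
      ≤ (max 1 ‖z‖) ^ (n.factorization.sum fun _ v => min v 2) :=
        pow_le_pow_left₀ (norm_nonneg _) (le_max_right _ _) _
    _ ≤ (max 1 ‖z‖) ^ (2 * ω n) := pow_le_pow_right₀ (le_max_left _ _) (capExp_le n)

/-- **Absolute convergence of `Σ z^{s(n)} n^{-s}` for `σ > 1`** (comparison with
`Σ (max(1,|z|)²)^{ω(n)} n^{-σ}`, `SatheSelberg.summable_norm_term_omegaCoeff`). [folklore] -/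
theorem summable_norm_term (z : ℂ) {s : ℂ} (hs : 1 < s.re) :
    Summable fun n ↦ ‖term (fun n : ℕ ↦ z ^ (n.factorization.sum fun _ v => min v 2)) s n‖ :=
  (SatheSelberg.summable_norm_term_omegaCoeff _ hs).of_nonneg_of_le (fun _ ↦ norm_nonneg _)
    fun n ↦ norm_term_le s (norm_coeff_le z n)

/-! ### The local factors and the Euler product of `Σ z^{s(n)} n^{-s}` -/

/-- The terms at prime powers: `a_z(p^e) (p^e)^{-s} = z^{min(e,2)} (p^{-s})^e`. [folklore] -/
theorem term_prime_pow (z s : ℂ) {p : ℕ} (hp : p.Prime) (e : ℕ) :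
    term (fun n : ℕ ↦ z ^ (n.factorization.sum fun _ v => min v 2)) s (p ^ e) =
      z ^ (min e 2) * ((p : ℂ) ^ (-s)) ^ e := by
  have hpe : p ^ e ≠ 0 := pow_ne_zero _ hp.ne_zero
  have hcap : ((p ^ e).factorization.sum fun _ v => min v 2) = min e 2 := by
    rw [hp.factorization_pow, Finsupp.sum_single_index]
    simp
  simp only [term_of_ne_zero hpe, hcap]
  rw [Nat.cast_pow, ← cpow_nat_mul, ← natCast_cpow_natCast_mul, div_eq_mul_inv, ← cpow_neg,
    mul_neg]

/-- The local factor at `p`: `Σ_e a_z(p^e) p^{-es} = 1 + z q + z² q²/(1 − q)`, `q = p^{-s}`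
(`σ > 0`). [folklore] -/
theorem hasSum_term_prime_pow (z : ℂ) {s : ℂ} (hs : 0 < s.re) (p : Nat.Primes) :
    HasSum (fun e : ℕ ↦ term (fun n : ℕ ↦ z ^ (n.factorization.sum fun _ v => min v 2)) s
        ((p : ℕ) ^ e))
      (1 + z * (p : ℂ) ^ (-s) + z ^ 2 * ((p : ℂ) ^ (-s)) ^ 2 / (1 - (p : ℂ) ^ (-s))) := by
  set q : ℂ := (p : ℂ) ^ (-s) with hq
  have hqn : ‖q‖ < 1 := by
    rw [hq, SatheSelberg.norm_primes_cpow_neg]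
    exact SatheSelberg.prime_rpow_neg_lt_one p.prop hs
  have e3 : (fun e : ℕ ↦ term (fun n : ℕ ↦ z ^ (n.factorization.sum fun _ v => min v 2)) s
      ((p : ℕ) ^ e)) = fun e ↦ z ^ (min e 2) * q ^ e :=
    funext fun e ↦ term_prime_pow z s p.prop e
  rw [e3]
  have hgeom : HasSum (fun n : ℕ ↦ z ^ (min (n + 2) 2) * q ^ (n + 2)) (z ^ 2 * q ^ 2 / (1 - q)) := by
    have h := (hasSum_geometric_of_norm_lt_one hqn).mul_left (z ^ 2 * q ^ 2)
    have e1 : (fun n : ℕ ↦ z ^ (min (n + 2) 2) * q ^ (n + 2)) = fun n ↦ z ^ 2 * q ^ 2 * q ^ n := by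
      funext n; rw [show min (n + 2) 2 = 2 by omega, pow_add]; ring
    rw [e1, div_eq_mul_inv]
    exact h
  have h2 := HasSum.sum_range_add (f := fun e : ℕ ↦ z ^ (min e 2) * q ^ e) (k := 2) hgeom
  convert h2 using 1
  simp [Finset.sum_range_succ]

/-- **The Euler product** `Σ z^{s(n)} n^{-s} = ∏_p (1 + z q + z² q²/(1 − q))` for `σ > 1`. [folklore] -/
theorem hasProd_LSeries (z : ℂ) {s : ℂ} (hs : 1 < s.re) :
    HasProd (fun p : Nat.Primes ↦
      1 + z * (p : ℂ) ^ (-s) + z ^ 2 * ((p : ℂ) ^ (-s)) ^ 2 / (1 - (p : ℂ) ^ (-s)))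
      (LSeries (fun n : ℕ ↦ z ^ (n.factorization.sum fun _ v => min v 2)) s) := by
  set a : ℕ → ℂ := fun n : ℕ ↦ z ^ (n.factorization.sum fun _ v => min v 2) with ha
  have h1 : term a s 1 = 1 := by simp [ha]
  -- `a` is multiplicative: `s(mn) = s(m) + s(n)` for coprime `m`, `n` (disjoint prime supports)
  have hmul : ∀ {m n : ℕ}, m.Coprime n → term a s (m * n) = term a s m * term a s n := by
    intro m n hmn
    refine SatheSelberg.term_mul_of_coprime (f := a) (fun {m n} h' ↦ ?_) s hmn
    simp only [ha, ← pow_add]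
    congr 1
    rw [Nat.factorization_mul_of_coprime h', Finsupp.sum_add_index_of_disjoint]
    rw [Nat.support_factorization, Nat.support_factorization]
    exact h'.disjoint_primeFactors
  have hE := EulerProduct.eulerProduct_hasProd h1 hmul (summable_norm_term z hs) (term_zero _ _)
  have heq : (fun p : Nat.Primes ↦ ∑' e : ℕ, term a s ((p : ℕ) ^ e)) =
      fun p : Nat.Primes ↦
        1 + z * (p : ℂ) ^ (-s) + z ^ 2 * ((p : ℂ) ^ (-s)) ^ 2 / (1 - (p : ℂ) ^ (-s)) :=
    funext fun p ↦ (hasSum_term_prime_pow z (by linarith) p).tsum_eq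
  rw [heq] at hE
  exact hE

/-! ### The factors `E_p(s, z)`: two estimates for an abstract `q = p^{-s}` -/

/-- **Quadratic closeness to `1`**: for `‖q‖ ≤ 3/4` and `‖z‖ ‖q‖ ≤ 1/4`,
`‖(1 + z q + z² q²/(1 − q)) exp(z Log(1 − q)) − 1‖ ≤ 20 (‖z‖ + ‖z‖²) ‖q‖²`
(write `exp(z Log(1 − q)) = 1 + w + ε`, `w = z(ℓ − q)`, `ℓ = Log(1 − q) + q = O(q²)`, `ε = O(w²)`;
the first-order terms `zq` cancel). [folklore] -/
theorem norm_capFactor_sub_one_le {q z : ℂ} (hq : ‖q‖ ≤ 3 / 4) (hzq : ‖z‖ * ‖q‖ ≤ 1 / 4) :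
    ‖(1 + z * q + z ^ 2 * q ^ 2 / (1 - q)) * exp (z * log (1 - q)) - 1‖ ≤
      20 * (‖z‖ + ‖z‖ ^ 2) * ‖q‖ ^ 2 := by
  set t : ℝ := ‖q‖ with ht
  set r : ℝ := ‖z‖ with hr
  have ht0 : 0 ≤ t := norm_nonneg _
  have hr0 : 0 ≤ r := norm_nonneg _
  have hu0 : 0 ≤ r * t := mul_nonneg hr0 ht0
  have hnq : ‖-q‖ < 1 := by rw [norm_neg]; linarith
  have h1q : (1 : ℂ) - q ≠ 0 := by
    intro h
    have : ‖q‖ = 1 := by rw [← sub_eq_zero.1 h]; simp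
    linarith
  have h1qn : 1 / 4 ≤ ‖1 - q‖ := by
    have := norm_sub_norm_le (1 : ℂ) q
    rw [norm_one] at this
    linarith
  -- `ℓ = Log(1 - q) + q`, `‖ℓ‖ ≤ 2t²`
  set ℓ : ℂ := log (1 - q) + q with hℓdef
  have hℓ : ‖ℓ‖ ≤ 2 * t ^ 2 := by
    have h := norm_log_one_add_sub_self_le hnq
    rw [norm_neg, ← sub_eq_add_neg, sub_neg_eq_add] at h
    have h2 : (1 - t)⁻¹ ≤ 4 := by
      rw [inv_le_comm₀ (by linarith) (by norm_num)]; linarith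
    calc ‖ℓ‖ ≤ t ^ 2 * (1 - t)⁻¹ / 2 := h
      _ ≤ t ^ 2 * 4 / 2 := by gcongr
      _ = 2 * t ^ 2 := by ring
  -- `w = z Log(1 - q) = zℓ − zq`, `‖w‖ ≤ (5/2) r t ≤ 5/8`
  set w : ℂ := z * log (1 - q) with hwdef
  have hlog : log (1 - q) = ℓ - q := by rw [hℓdef]; ring
  have ht2 : t ^ 2 ≤ 3 / 4 * t := by nlinarith
  have hw : ‖w‖ ≤ 5 / 2 * (r * t) := by
    rw [hwdef, hlog, mul_sub]
    calc ‖z * ℓ - z * q‖ ≤ ‖z * ℓ‖ + ‖z * q‖ := norm_sub_le _ _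
      _ = r * ‖ℓ‖ + r * t := by rw [norm_mul, norm_mul]
      _ ≤ r * (2 * t ^ 2) + r * t := by gcongr
      _ ≤ 5 / 2 * (r * t) := by nlinarith [mul_le_mul_of_nonneg_left ht2 hr0]
  have hw1 : ‖w‖ ≤ 1 := by linarith
  -- `ε = e^w − 1 − w`, `‖ε‖ ≤ ‖w‖²`
  set ε : ℂ := exp w - 1 - w with hεdef
  have hε : ‖ε‖ ≤ (5 / 2 * (r * t)) ^ 2 :=
    (norm_exp_sub_one_sub_id_le hw1).trans (pow_le_pow_left₀ (norm_nonneg _) hw 2)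
  -- `A = zq`, `B = z²q²/(1 − q)`
  set A : ℂ := z * q with hAdef
  set B : ℂ := z ^ 2 * q ^ 2 / (1 - q) with hBdef
  have hA : ‖A‖ = r * t := norm_mul _ _
  have hB : ‖B‖ ≤ 4 * (r * t) ^ 2 := by
    rw [hBdef, norm_div, norm_mul, norm_pow, norm_pow, div_le_iff₀ (by linarith), ← hr, ← ht]
    nlinarith [sq_nonneg (r * t)]
  -- the algebraic identity (the first-order terms cancel)
  have key : (1 + z * q + z ^ 2 * q ^ 2 / (1 - q)) * exp (z * log (1 - q)) - 1 =
      z * ℓ + ε + A * (w + ε) + B * (1 + w + ε) := by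
    have hexp : exp (z * log (1 - q)) = 1 + w + ε := by rw [hεdef, hwdef]; ring
    rw [hexp, hwdef, hlog, hBdef, hAdef]
    ring
  rw [key]
  have hwε : ‖w + ε‖ ≤ 5 / 2 * (r * t) + (5 / 2 * (r * t)) ^ 2 :=
    (norm_add_le _ _).trans (add_le_add hw hε)
  have h1wε : ‖1 + w + ε‖ ≤ 1 + 5 / 2 * (r * t) + (5 / 2 * (r * t)) ^ 2 := by
    calc ‖1 + w + ε‖ ≤ ‖(1 : ℂ)‖ + ‖w‖ + ‖ε‖ := norm_add₃_le
      _ ≤ _ := by rw [norm_one]; linarith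
  have hP : 6.25 + 2.5 + 4 + 16.25 * (r * t) + 25 * (r * t) ^ 2 ≤ (20 : ℝ) := by nlinarith
  calc ‖z * ℓ + ε + A * (w + ε) + B * (1 + w + ε)‖
      ≤ ‖z * ℓ‖ + ‖ε‖ + ‖A * (w + ε)‖ + ‖B * (1 + w + ε)‖ := norm_add₄_le
    _ = r * ‖ℓ‖ + ‖ε‖ + r * t * ‖w + ε‖ + ‖B‖ * ‖1 + w + ε‖ := by
        rw [norm_mul z ℓ, norm_mul A, norm_mul B, hA]
    _ ≤ r * (2 * t ^ 2) + (5 / 2 * (r * t)) ^ 2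
          + (r * t) * (5 / 2 * (r * t) + (5 / 2 * (r * t)) ^ 2)
          + 4 * (r * t) ^ 2 * (1 + 5 / 2 * (r * t) + (5 / 2 * (r * t)) ^ 2) := by
        gcongr
    _ = 2 * r * t ^ 2
          + (r * t) ^ 2 * (6.25 + 2.5 + 4 + 16.25 * (r * t) + 25 * (r * t) ^ 2) := by ring
    _ ≤ 20 * r * t ^ 2 + (r * t) ^ 2 * 20 := by
        have h1 : 2 * r * t ^ 2 ≤ 20 * r * t ^ 2 := by nlinarith [mul_nonneg hr0 (sq_nonneg t)]
        nlinarith [mul_le_mul_of_nonneg_left hP (sq_nonneg (r * t))]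
    _ = 20 * (r + r ^ 2) * t ^ 2 := by ring

/-- **The explicit bound for one factor**: for `‖q‖ ≤ 3/4` and `‖z‖ ≤ R`,
`‖(1 + z q + z² q²/(1 − q)) exp(z Log(1 − q))‖ ≤ exp(30 (1 + R)^{3/2} ‖q‖^{3/2})`.
If `‖z‖‖q‖ ≤ 1/4` this is the quadratic closeness (`|z|²t² ≤ ½ (|z| t)^{3/2}`, `t² ≤ t^{3/2}`);
otherwise the crude bound `(1 + u + 4u²) e^{5u/2} ≤ e^{19 u^{3/2}}` (`u = ‖z‖‖q‖ ≥ 1/4`,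
`‖Log(1 − q)‖ ≤ 5t/2`). [folklore] -/
theorem norm_capFactor_le {q z : ℂ} {R : ℝ} (hq : ‖q‖ ≤ 3 / 4) (hz : ‖z‖ ≤ R) :
    ‖(1 + z * q + z ^ 2 * q ^ 2 / (1 - q)) * exp (z * log (1 - q))‖ ≤
      Real.exp (30 * ((1 + R) ^ (3 / 2 : ℝ) * ‖q‖ ^ (3 / 2 : ℝ))) := by
  set t : ℝ := ‖q‖ with ht
  set r : ℝ := ‖z‖ with hr
  have ht0 : 0 ≤ t := norm_nonneg _
  have hr0 : 0 ≤ r := norm_nonneg _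
  have hR : 0 ≤ R := hr0.trans hz
  have hu0 : 0 ≤ r * t := mul_nonneg hr0 ht0
  have e32 : ∀ x : ℝ, 0 ≤ x → x ^ (3 / 2 : ℝ) = x * Real.sqrt x := fun x hx ↦ by
    rw [show (3 / 2 : ℝ) = 1 + 1 / 2 by norm_num, Real.rpow_add' hx (by norm_num), Real.rpow_one,
      Real.sqrt_eq_rpow]
  rw [e32 _ (by linarith), e32 _ ht0]
  set M : ℝ := (1 + R) * Real.sqrt (1 + R) with hM
  set T : ℝ := t * Real.sqrt t with hT
  have hT0 : 0 ≤ T := mul_nonneg ht0 (Real.sqrt_nonneg _)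
  have hsq1 : 1 ≤ Real.sqrt (1 + R) := Real.one_le_sqrt.2 (by linarith)
  have hM1 : 1 + R ≤ M := le_mul_of_one_le_right (by linarith) hsq1
  have hM0 : 0 ≤ M := by linarith
  -- `r √r ≤ M`, `√(rt) = √r √t`
  have hrM : r * Real.sqrt r ≤ M :=
    mul_le_mul (by linarith) (Real.sqrt_le_sqrt (by linarith)) (Real.sqrt_nonneg _) (by linarith)
  set v : ℝ := Real.sqrt (r * t) with hv
  have hv0 : 0 ≤ v := Real.sqrt_nonneg _
  have hvv : v * v = r * t := Real.mul_self_sqrt hu0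
  have hv3 : (r * t) * v ≤ M * T := by
    rw [hv, Real.sqrt_mul hr0, hT]
    calc r * t * (Real.sqrt r * Real.sqrt t) = (r * Real.sqrt r) * (t * Real.sqrt t) := by ring
      _ ≤ M * (t * Real.sqrt t) := mul_le_mul_of_nonneg_right hrM hT0
  have hnq : ‖-q‖ < 1 := by rw [norm_neg]; linarith
  rcases le_or_gt (r * t) (1 / 4) with hu | hu
  · -- good factor: quadratic closeness
    have h1 := norm_capFactor_sub_one_le hq (by rw [← hr, ← ht]; exact hu)
    rw [← hr, ← ht] at h1
    have h2 : ‖(1 + z * q + z ^ 2 * q ^ 2 / (1 - q)) * exp (z * log (1 - q))‖ ≤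
        1 + 20 * (r + r ^ 2) * t ^ 2 := by
      calc ‖(1 + z * q + z ^ 2 * q ^ 2 / (1 - q)) * exp (z * log (1 - q))‖
          = ‖1 + ((1 + z * q + z ^ 2 * q ^ 2 / (1 - q)) * exp (z * log (1 - q)) - 1)‖ := by
            rw [add_sub_cancel]
        _ ≤ ‖(1 : ℂ)‖ + ‖(1 + z * q + z ^ 2 * q ^ 2 / (1 - q)) * exp (z * log (1 - q)) - 1‖ :=
            norm_add_le _ _
        _ ≤ _ := by rw [norm_one]; linarith
    refine h2.trans ?_
    rw [add_comm]
    refine (Real.add_one_le_exp _).trans (Real.exp_le_exp.2 ?_)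
    -- `20 r t² + 20 (rt)² ≤ 20 M T + 10 M T`
    have hv2 : v ≤ 1 / 2 := by
      rw [hv, Real.sqrt_le_left (by norm_num)]; linarith
    have htT : t ^ 2 ≤ T := by
      have : t ≤ Real.sqrt t := by
        rw [Real.le_sqrt ht0 ht0]; nlinarith
      rw [hT, sq]; exact mul_le_mul_of_nonneg_left this ht0
    have hA : r * t ^ 2 ≤ M * T := mul_le_mul (by linarith) htT (sq_nonneg _) hM0
    have hB : (r * t) ^ 2 ≤ 1 / 2 * (M * T) := by
      calc (r * t) ^ 2 = (r * t) * v * v := by rw [← hvv]; ring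
        _ ≤ (M * T) * (1 / 2) := mul_le_mul hv3 hv2 hv0 (mul_nonneg hM0 hT0)
        _ = 1 / 2 * (M * T) := by ring
    nlinarith
  · -- bad factor: crude bound
    have hv2 : 1 / 2 < v := by
      by_contra h
      push Not at h
      have : r * t ≤ 1 / 4 := by rw [← hvv]; nlinarith
      linarith
    have h1t : 1 - t ≤ ‖1 - q‖ := by
      have := norm_sub_norm_le (1 : ℂ) q
      rw [norm_one] at this
      linarith
    -- the rational factor
    have hrat : ‖1 + z * q + z ^ 2 * q ^ 2 / (1 - q)‖ ≤ 1 + r * t + 4 * (r * t) ^ 2 := by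
      have hB : ‖z ^ 2 * q ^ 2 / (1 - q)‖ ≤ 4 * (r * t) ^ 2 := by
        rw [norm_div, norm_mul, norm_pow, norm_pow, div_le_iff₀ (by linarith), ← hr, ← ht]
        nlinarith [sq_nonneg (r * t)]
      calc ‖1 + z * q + z ^ 2 * q ^ 2 / (1 - q)‖
          ≤ ‖(1 : ℂ)‖ + ‖z * q‖ + ‖z ^ 2 * q ^ 2 / (1 - q)‖ := norm_add₃_le
        _ ≤ 1 + r * t + 4 * (r * t) ^ 2 := by rw [norm_one, norm_mul]; linarith
    -- the exponential factor
    have hlog : ‖log (1 - q)‖ ≤ 5 / 2 * t := by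
      have h := norm_log_one_add_le hnq
      rw [norm_neg, ← sub_eq_add_neg] at h
      have h2 : (1 - t)⁻¹ ≤ 4 := by
        rw [inv_le_comm₀ (by linarith) (by norm_num)]; linarith
      calc ‖log (1 - q)‖ ≤ t ^ 2 * (1 - t)⁻¹ / 2 + t := h
        _ ≤ t ^ 2 * 4 / 2 + t := by gcongr
        _ ≤ 5 / 2 * t := by nlinarith
    have hexpf : ‖exp (z * log (1 - q))‖ ≤ Real.exp (5 / 2 * (r * t)) := by
      calc ‖exp (z * log (1 - q))‖ ≤ Real.exp ‖z * log (1 - q)‖ := norm_exp_le_exp_norm _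
        _ ≤ Real.exp (5 / 2 * (r * t)) := by
            rw [Real.exp_le_exp, norm_mul, ← hr]
            calc r * ‖log (1 - q)‖ ≤ r * (5 / 2 * t) := mul_le_mul_of_nonneg_left hlog hr0
              _ = 5 / 2 * (r * t) := by ring
    -- polynomial ≤ exponential in `v³ = (rt)^{3/2}`
    have hv3' : (r * t) * v = v ^ 3 := by rw [← hvv]; ring
    have hpoly : 1 + r * t + 4 * (r * t) ^ 2 ≤ Real.exp (14 * v ^ 3) := by
      refine le_trans ?_ (Real.quadratic_le_exp_of_nonneg (by positivity))
      rw [← hvv]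
      nlinarith [pow_le_pow_left₀ (by norm_num : (0 : ℝ) ≤ 1 / 2) hv2.le 2,
        pow_le_pow_left₀ (by norm_num : (0 : ℝ) ≤ 1 / 2) hv2.le 4,
        pow_le_pow_left₀ (by norm_num : (0 : ℝ) ≤ 1 / 2) hv2.le 6, pow_nonneg hv0 6]
    have hlin : 5 / 2 * (r * t) ≤ 5 * v ^ 3 := by rw [← hvv]; nlinarith
    calc ‖(1 + z * q + z ^ 2 * q ^ 2 / (1 - q)) * exp (z * log (1 - q))‖
        = ‖1 + z * q + z ^ 2 * q ^ 2 / (1 - q)‖ * ‖exp (z * log (1 - q))‖ := norm_mul _ _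
      _ ≤ Real.exp (14 * v ^ 3) * Real.exp (5 * v ^ 3) :=
          mul_le_mul (hrat.trans hpoly) (hexpf.trans (Real.exp_le_exp.2 hlin)) (norm_nonneg _)
            (Real.exp_nonneg _)
      _ = Real.exp (14 * v ^ 3 + 5 * v ^ 3) := (Real.exp_add _ _).symm
      _ ≤ Real.exp (30 * (M * T)) := by
          rw [Real.exp_le_exp]
          linarith [mul_nonneg hM0 hT0]

end SelbergDelangeCapped

end Literature.NumberTheory.LFunctions
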